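import Mathlib
import HarnessLib
import Summits.NavierStokesRegularity.NavierStokesRegularity.Theorems.PoloidalWindowDoorLrcModEntirePeaklessPlanarMaxPrinciple

/-!
# Item `LrcModEntire` (stmt-NavierStokesRegularity-20428), registry twist_split v7 — RIDGE QUASICONVEXITY from Peakless
# (rung (Q1) of the «ridge quasiconvexity» lever, memo `Cruxes/LrcModEntire/T2B-g14.md` §9, in TUBE-CHART form; plus the two generic quasiconvexity tools the lever uses)

LEAD of item 20428 ns-poloidal-K2-p3 g14 (`--supports stmt-NavierStokesRegularity-20428 --as helper`; sequel of `…PeaklessPlanarMaxPrinciple` (p704227, (Q0))).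

A TUBE CHART at height `z₀` is an `OpenPartialHomeomorph e` of `ℝ × ℝ` whose source contains a closed rectangle `[a₁,a₂] × [−r,r]` («arclength × normal
coordinate»), read in the plane `{y₂ = z₀}` through `P : ℝ × ℝ → ℝ³`, `q ↦ (q.1, q.2, z₀)`.  For a field `v` with the Peakless property (binder VERBATIM
from the K2 cells `stub_T2b` / `stub_C2a'` / `stub_C2b'`), a time `s < 0`, a sign `σ = ±1`, and `F(a,n) := σ·v₂(s, P (e (a,n)))`:

* `exists_end_ge_of_peakless` — **(Q1) the maximum over every sub-tube sits on an END cross-section**: if the LATERAL values `F(a, ±r)` (`a ∈ [a₁,a₂]`) stay strictly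
  below a level `m` that the CENTRE curve dominates (`m ≤ F(a,0)`), then for `a₁ ≤ b₁ ≤ c ≤ b₂ ≤ a₂` every value `F(c,n)`, `|n| ≤ r`, is `≤ F(a,n′)` for some end
  `a ∈ {b₁,b₂}` and some `|n′| ≤ r`.  (Proof: (Q0) `exists_isMaxOn_diff_of_peakless` on the compact planar set `D = P (e([b₁,b₂]×[−r,r]))` with the open
  `U = {y : (y₀,y₁) ∈ e((b₁,b₂)×(−r,r))}`; a maximiser outside `U` has chart coordinates on the boundary of the rectangle; the lateral sides are excluded by the level `m`.)
* `crossSectionMax_quasiconvexOn_of_peakless` — the same in the language of Mathlib: the cross-section maximum `R(a) := sSup (F(a,·) '' [−r,r])` is `QuasiconvexOn ℝ [a₁,a₂]`.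
* generic tools (real functions of one variable; [folklore]): `quasiconvexOn_of_tendsto` — a pointwise limit of quasiconvex functions on a convex set is quasiconvex;
  `QuasiconvexOn.eq_of_periodic` — a quasiconvex function on `ℝ` with a period is constant (the «recurrent ridge ⇒ homogeneous» step (Q3) in its simplest form).

How a cell-prover uses it (memo §9): around a hot arc `γ` of the web `H ⊂ P₀` (away from vertices) the normal-bundle map `(a,n) ↦ γ(a) + nν(a)` is a tube chart for small `r`
(inverse function theorem); off `H`, `v₂(−1,·) < N`, so the lateral level `m = N − η/2` works for all `(t, z₀)` near `(−1, 0)` by continuity, while the centre curve stays above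
it; hence the cross-section maximum is quasiconvex along the arc for all nearby times and heights, and its Taylor coefficients in `(t+1, z₀)` are quasiconvex (even orders) /
monotone (odd orders) along the arc by `quasiconvexOn_of_tendsto`.

WHAT THIS IS NOT: not a claim about Navier–Stokes regularity — a reformulation of the Peakless hypothesis of the registered research stubs + two convexity lemmas (bears_on
LADDER-NS N0, item 20428 / crux 19708; both OPEN, ⟨27893⟩ OPEN).
-/

noncomputable section

-- the summit and its single sub-problem share the name (CONVENTIONS §1), as in every Theorems file
set_option linter.dupNamespace false

namespace Summit.NavierStokesRegularity.NavierStokesRegularity.Theorems.PoloidalWindowDoorLrcModEntireRidgeQuasiconvex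

open Set Filter Topology Metric
open Summit.NavierStokesRegularity.NavierStokesRegularity.Theorems.PoloidalWindowDoorLrcModEntirePeaklessPlanarMaxPrinciple

/-! ### Generic quasiconvexity tools (one real variable) -/

/-- **A pointwise limit of quasiconvex functions is quasiconvex** (on a convex set, along any non-trivial filter). [folklore] -/
theorem quasiconvexOn_of_tendsto {ι : Type*} {l : Filter ι} [l.NeBot] {S : Set ℝ} (hS : Convex ℝ S) {F : ι → ℝ → ℝ} {f : ℝ → ℝ}
    (hF : ∀ i, QuasiconvexOn ℝ S (F i)) (hlim : ∀ x ∈ S, Tendsto (fun i => F i x) l (𝓝 (f x))) : QuasiconvexOn ℝ S f := by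
  rw [quasiconvexOn_iff_le_max]
  refine ⟨hS, fun x hx y hy a b ha hb hab => ?_⟩
  have hmem : a • x + b • y ∈ S := hS hx hy ha hb hab
  have h1 : Tendsto (fun i => F i (a • x + b • y)) l (𝓝 (f (a • x + b • y))) := hlim _ hmem
  have h2 : Tendsto (fun i => max (F i x) (F i y)) l (𝓝 (max (f x) (f y))) := (hlim x hx).max (hlim y hy)
  exact le_of_tendsto_of_tendsto' h1 h2 fun i => ((quasiconvexOn_iff_le_max.1 (hF i)).2 hx hy ha hb hab)

/-- **A quasiconvex function on `ℝ` with a period is constant** («recurrent ridge ⇒ homogeneous data», simplest case). [folklore] -/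
theorem QuasiconvexOn.eq_of_periodic {f : ℝ → ℝ} (hf : QuasiconvexOn ℝ univ f) {T : ℝ} (hT : 0 < T) (hper : Function.Periodic f T) (x y : ℝ) :
    f x = f y := by
  have key : ∀ x y : ℝ, f y ≤ f x := by
    intro x y
    -- choose `k` with `y ∈ [x − kT, x + kT]`
    obtain ⟨k, hk⟩ : ∃ k : ℕ, |y - x| ≤ k * T := by
      obtain ⟨k, hk⟩ := exists_nat_ge (|y - x| / T)
      exact ⟨k, by rwa [div_le_iff₀ hT] at hk⟩
    have hkT : 0 ≤ (k : ℝ) * T := by positivity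
    have hxm : f (x - k * T) = f x := hper.sub_nat_mul_eq k
    have hxp : f (x + k * T) = f x := (hper.nat_mul k) x
    rcases (abs_le.1 hk) with ⟨h1, h2⟩
    -- `y` is a convex combination of `x − kT` and `x + kT`
    rcases eq_or_lt_of_le hkT with h0 | hpos
    · have hyx : y = x := by
        have habs : |y - x| ≤ 0 := by rw [h0]; exact hk
        have := abs_nonneg (y - x)
        have h00 : |y - x| = 0 := le_antisymm habs this
        linarith [abs_eq_zero.1 h00]
      rw [hyx]
    · set L : ℝ := (k : ℝ) * T with hL
      set a : ℝ := (x + L - y) / (2 * L) with ha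
      set b : ℝ := (y - (x - L)) / (2 * L) with hb
      have hL0 : L ≠ 0 := hpos.ne'
      have ha0 : 0 ≤ a := by rw [ha]; exact div_nonneg (by linarith) (by positivity)
      have hb0 : 0 ≤ b := by rw [hb]; exact div_nonneg (by linarith) (by positivity)
      have hab : a + b = 1 := by rw [ha, hb]; field_simp; ring
      have hy : a • (x - L) + b • (x + L) = y := by
        simp only [smul_eq_mul]; rw [ha, hb]; field_simp; ring
      have h := (quasiconvexOn_iff_le_max.1 hf).2 (mem_univ (x - L)) (mem_univ (x + L)) ha0 hb0 hab
      rw [hy, hxm, hxp, max_self] at h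
      exact h
  exact le_antisymm (key y x) (key x y)

/-! ### The tube chart and (Q1) -/

/-- Bookkeeping for a «plane point» map `P q = (q.1, q.2, z₀)` given by its defining equation: coordinates and continuity. -/
theorem planePoint_facts {z₀ : ℝ} {P : ℝ × ℝ → EuclideanSpace ℝ (Fin 3)} (hP : ∀ q, P q = WithLp.toLp 2 ![q.1, q.2, z₀]) :
    (∀ q, P q 0 = q.1) ∧ (∀ q, P q 1 = q.2) ∧ (∀ q, P q 2 = z₀) ∧ Continuous P := by
  have hPe : P = fun q => WithLp.toLp 2 ![q.1, q.2, z₀] := funext hP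
  refine ⟨fun q => by simp [hP], fun q => by simp [hP], fun q => by simp [hP], ?_⟩
  rw [hPe]
  refine (PiLp.continuous_toLp 2 _).comp (continuous_pi fun i => ?_)
  fin_cases i <;> simp <;> fun_prop

variable {v : ℝ → EuclideanSpace ℝ (Fin 3) → EuclideanSpace ℝ (Fin 3)}

/-- **(Q1) RIDGE QUASICONVEXITY, tube-chart form: the maximum over a sub-tube sits on an end cross-section.**  See the module docstring. -/
theorem exists_end_ge_of_peakless
    (hpk : ∀ (s z₀ σ M : ℝ) (K O : Set (EuclideanSpace ℝ (Fin 3))), s < 0 →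
      ((σ = 1 ∨ σ = -1) ∧ IsCompact K ∧ K.Nonempty ∧ (∀ y ∈ K, y 2 = z₀ ∧ σ * v s y 2 = M) ∧
        IsOpen O ∧ K ⊆ O ∧ (∀ y ∈ O, y 2 = z₀ → σ * v s y 2 ≤ M) ∧
        (∀ y ∈ O, y 2 = z₀ → σ * v s y 2 = M → y ∈ K)) → False)
    {s : ℝ} (hs : s < 0) {z₀ σ : ℝ} (hσ : σ = 1 ∨ σ = -1) (hvc : Continuous fun y => v s y 2)
    {P : ℝ × ℝ → EuclideanSpace ℝ (Fin 3)} (hP : ∀ q, P q = WithLp.toLp 2 ![q.1, q.2, z₀])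
    (e : OpenPartialHomeomorph (ℝ × ℝ) (ℝ × ℝ)) {a₁ a₂ r : ℝ} (hr : 0 ≤ r) (hsrc : Icc a₁ a₂ ×ˢ Icc (-r) r ⊆ e.source)
    {m : ℝ} (hlat : ∀ a ∈ Icc a₁ a₂, ∀ n : ℝ, (n = r ∨ n = -r) → σ * v s (P (e (a, n))) 2 < m)
    (hmid : ∀ a ∈ Icc a₁ a₂, m ≤ σ * v s (P (e (a, 0))) 2)
    {b₁ c b₂ : ℝ} (hb₁ : a₁ ≤ b₁) (hc₁ : b₁ ≤ c) (hc₂ : c ≤ b₂) (hb₂ : b₂ ≤ a₂) {n : ℝ} (hn : n ∈ Icc (-r) r) :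
    ∃ a : ℝ, (a = b₁ ∨ a = b₂) ∧ ∃ n' ∈ Icc (-r) r,
      σ * v s (P (e (c, n))) 2 ≤ σ * v s (P (e (a, n'))) 2 := by
  obtain ⟨hP0, hP1, hP2, hPc⟩ := planePoint_facts hP
  set f : EuclideanSpace ℝ (Fin 3) → ℝ := fun y => σ * v s y 2 with hf
  set Q : Set (ℝ × ℝ) := Icc b₁ b₂ ×ˢ Icc (-r) r with hQ
  set Qo : Set (ℝ × ℝ) := Ioo b₁ b₂ ×ˢ Ioo (-r) r with hQo
  have hQsub : Q ⊆ Icc a₁ a₂ ×ˢ Icc (-r) r :=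
    prod_mono (Icc_subset_Icc hb₁ hb₂) Subset.rfl
  have hQsrc : Q ⊆ e.source := hQsub.trans hsrc
  have hQc : IsCompact Q := (isCompact_Icc.prod isCompact_Icc)
  -- the compact planar set `D` and the open `U`
  set D : Set (EuclideanSpace ℝ (Fin 3)) := P '' (e '' Q) with hD
  have hDc : IsCompact D := (hQc.image_of_continuousOn (e.continuousOn.mono hQsrc)).image hPc
  have hcQ : (c, n) ∈ Q := ⟨⟨hc₁, hc₂⟩, hn⟩
  have hDne : D.Nonempty := ⟨P (e (c, n)), e (c, n), ⟨(c, n), hcQ, rfl⟩, rfl⟩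
  have hDz : ∀ y ∈ D, y 2 = z₀ := by
    rintro y ⟨q, -, rfl⟩; exact hP2 q
  set U : Set (EuclideanSpace ℝ (Fin 3)) := {y | ((y 0, y 1) : ℝ × ℝ) ∈ e '' Qo} with hU
  have hQo_open : IsOpen Qo := isOpen_Ioo.prod isOpen_Ioo
  have hQoQ : Qo ⊆ Q := prod_mono Ioo_subset_Icc_self Ioo_subset_Icc_self
  have hUo : IsOpen U := by
    have h1 : IsOpen (e '' Qo) := e.isOpen_image_of_subset_source hQo_open (hQoQ.trans hQsrc)
    have h2 : Continuous fun y : EuclideanSpace ℝ (Fin 3) => ((y 0, y 1) : ℝ × ℝ) :=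
      ((EuclideanSpace.proj (𝕜 := ℝ) (0 : Fin 3)).continuous).prodMk ((EuclideanSpace.proj (𝕜 := ℝ) (1 : Fin 3)).continuous)
    exact h1.preimage h2
  have hUD : ∀ y ∈ U, y 2 = z₀ → y ∈ D := by
    intro y hy hyz
    obtain ⟨q, hq, hqe⟩ := hy
    refine ⟨e q, ⟨q, hQoQ hq, rfl⟩, ?_⟩
    rw [hP]
    ext i
    fin_cases i
    · simpa using congrArg Prod.fst hqe
    · simpa using congrArg Prod.snd hqe
    · simpa using hyz.symm
  -- (Q0)
  obtain ⟨y, ⟨hyD, hyU⟩, hmax⟩ :=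
    exists_isMaxOn_diff_of_peakless hpk hs hσ hDc hDne hDz (hvc.continuousOn) hUo hUD
  obtain ⟨q', ⟨q, hq, rfl⟩, rfl⟩ := hyD
  -- `q ∈ Q \ Qo`: a boundary point of the rectangle
  have hqo : q ∉ Qo := fun hq' => hyU ⟨q, hq', by simp [hP0, hP1]⟩
  obtain ⟨⟨hq1l, hq1r⟩, ⟨hq2l, hq2r⟩⟩ := hq
  have hqa : q.1 ∈ Icc a₁ a₂ := ⟨hb₁.trans hq1l, hq1r.trans hb₂⟩
  -- the value at the maximiser dominates the centre value at `q.1`, hence it is not a lateral point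
  have hge : m ≤ f (P (e q)) := by
    have h0Q : (q.1, (0 : ℝ)) ∈ Q := ⟨⟨hq1l, hq1r⟩, ⟨by linarith, hr⟩⟩
    exact (hmid q.1 hqa).trans (hmax _ ⟨e (q.1, 0), ⟨(q.1, 0), h0Q, rfl⟩, rfl⟩)
  have hnotlat : ¬ (q.2 = r ∨ q.2 = -r) := fun hl => by
    have := hlat q.1 hqa q.2 hl
    rw [show (q.1, q.2) = q from rfl] at this
    exact absurd hge (not_le.2 this)
  -- so `q.1 ∈ {b₁, b₂}`
  have hends : q.1 = b₁ ∨ q.1 = b₂ := by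
    by_contra hcon
    push Not at hcon
    have h1 : q.1 ∈ Ioo b₁ b₂ := ⟨lt_of_le_of_ne hq1l (Ne.symm hcon.1), lt_of_le_of_ne hq1r hcon.2⟩
    have h2 : q.2 ∈ Ioo (-r) r := by
      push Not at hnotlat
      exact ⟨lt_of_le_of_ne hq2l (Ne.symm hnotlat.2), lt_of_le_of_ne hq2r hnotlat.1⟩
    exact hqo ⟨h1, h2⟩
  refine ⟨q.1, hends, q.2, ⟨hq2l, hq2r⟩, ?_⟩
  have := hmax (P (e (c, n))) ⟨e (c, n), ⟨(c, n), hcQ, rfl⟩, rfl⟩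
  simpa [hf] using this

/-- **(Q1) in Mathlib's language: the cross-section maximum is quasiconvex along the tube.**  With `R a := sSup ((fun n => σ·v₂(s, P (e (a,n)))) '' [−r,r])`
(a maximum: the cross-section is compact and the integrand continuous), `R` is `QuasiconvexOn ℝ [a₁,a₂]`. -/
theorem crossSectionMax_quasiconvexOn_of_peakless
    (hpk : ∀ (s z₀ σ M : ℝ) (K O : Set (EuclideanSpace ℝ (Fin 3))), s < 0 →
      ((σ = 1 ∨ σ = -1) ∧ IsCompact K ∧ K.Nonempty ∧ (∀ y ∈ K, y 2 = z₀ ∧ σ * v s y 2 = M) ∧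
        IsOpen O ∧ K ⊆ O ∧ (∀ y ∈ O, y 2 = z₀ → σ * v s y 2 ≤ M) ∧
        (∀ y ∈ O, y 2 = z₀ → σ * v s y 2 = M → y ∈ K)) → False)
    {s : ℝ} (hs : s < 0) {z₀ σ : ℝ} (hσ : σ = 1 ∨ σ = -1) (hvc : Continuous fun y => v s y 2)
    {P : ℝ × ℝ → EuclideanSpace ℝ (Fin 3)} (hP : ∀ q, P q = WithLp.toLp 2 ![q.1, q.2, z₀])
    (e : OpenPartialHomeomorph (ℝ × ℝ) (ℝ × ℝ)) {a₁ a₂ r : ℝ} (hr : 0 ≤ r) (hsrc : Icc a₁ a₂ ×ˢ Icc (-r) r ⊆ e.source)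
    {m : ℝ} (hlat : ∀ a ∈ Icc a₁ a₂, ∀ n : ℝ, (n = r ∨ n = -r) → σ * v s (P (e (a, n))) 2 < m)
    (hmid : ∀ a ∈ Icc a₁ a₂, m ≤ σ * v s (P (e (a, 0))) 2) :
    QuasiconvexOn ℝ (Icc a₁ a₂) fun a => sSup ((fun n : ℝ => σ * v s (P (e (a, n))) 2) '' Icc (-r) r) := by
  obtain ⟨-, -, -, hPc⟩ := planePoint_facts hP
  set F : ℝ → ℝ → ℝ := fun a n => σ * v s (P (e (a, n))) 2 with hF
  -- each cross-section image is compact and non-empty, so `sSup` is attained and bounds every value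
  have hsec : ∀ a ∈ Icc a₁ a₂, IsCompact (F a '' Icc (-r) r) ∧ (F a '' Icc (-r) r).Nonempty := by
    intro a ha
    refine ⟨isCompact_Icc.image_of_continuousOn ?_, ⟨F a 0, 0, ⟨by linarith, hr⟩, rfl⟩⟩
    have hline : ContinuousOn (fun n : ℝ => e (a, n)) (Icc (-r) r) :=
      e.continuousOn.comp (Continuous.continuousOn (by fun_prop)) fun n hn => hsrc ⟨ha, hn⟩
    exact (continuousOn_const.mul ((hvc.comp hPc).comp_continuousOn hline))
  have hle : ∀ a ∈ Icc a₁ a₂, ∀ n ∈ Icc (-r) r, F a n ≤ sSup (F a '' Icc (-r) r) := fun a ha n hn =>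
    le_csSup (hsec a ha).1.bddAbove ⟨n, hn, rfl⟩
  have hmem : ∀ a ∈ Icc a₁ a₂, sSup (F a '' Icc (-r) r) ∈ F a '' Icc (-r) r := fun a ha =>
    (hsec a ha).1.sSup_mem (hsec a ha).2
  rw [quasiconvexOn_iff_le_max]
  refine ⟨convex_Icc a₁ a₂, fun x hx y hy a b ha hb hab => ?_⟩
  -- wlog order the endpoints
  have hc : a • x + b • y ∈ Icc a₁ a₂ := (convex_Icc a₁ a₂) hx hy ha hb hab
  obtain ⟨n₀, hn₀, hn₀eq⟩ := hmem _ hc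
  rw [← hn₀eq]
  rcases le_total x y with hxy | hxy
  · have e1 : a • x + b • y = x + b * (y - x) := by
      rw [smul_eq_mul, smul_eq_mul, show a = 1 - b by linarith]; ring
    have e2 : a • x + b • y = y - a * (y - x) := by
      rw [smul_eq_mul, smul_eq_mul, show b = 1 - a by linarith]; ring
    have hcx : x ≤ a • x + b • y := by rw [e1]; nlinarith [mul_nonneg hb (sub_nonneg.2 hxy)]
    have hcy : a • x + b • y ≤ y := by rw [e2]; nlinarith [mul_nonneg ha (sub_nonneg.2 hxy)]
    obtain ⟨a', ha', n', hn', hle'⟩ := exists_end_ge_of_peakless hpk hs hσ hvc hP e hr hsrc hlat hmid hx.1 hcx hcy hy.2 hn₀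
    rcases ha' with rfl | rfl
    · exact (hle'.trans (hle _ hx n' hn')).trans (le_max_left _ _)
    · exact (hle'.trans (hle _ hy n' hn')).trans (le_max_right _ _)
  · have e1 : a • x + b • y = y + a * (x - y) := by
      rw [smul_eq_mul, smul_eq_mul, show b = 1 - a by linarith]; ring
    have e2 : a • x + b • y = x - b * (x - y) := by
      rw [smul_eq_mul, smul_eq_mul, show a = 1 - b by linarith]; ring
    have hcy : y ≤ a • x + b • y := by rw [e1]; nlinarith [mul_nonneg ha (sub_nonneg.2 hxy)]
    have hcx : a • x + b • y ≤ x := by rw [e2]; nlinarith [mul_nonneg hb (sub_nonneg.2 hxy)]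
    obtain ⟨a', ha', n', hn', hle'⟩ := exists_end_ge_of_peakless hpk hs hσ hvc hP e hr hsrc hlat hmid hy.1 hcy hcx hx.2 hn₀
    rcases ha' with rfl | rfl
    · exact (hle'.trans (hle _ hy n' hn')).trans (le_max_right _ _)
    · exact (hle'.trans (hle _ hx n' hn')).trans (le_max_left _ _)

end Summit.NavierStokesRegularity.NavierStokesRegularity.Theorems.PoloidalWindowDoorLrcModEntireRidgeQuasiconvex
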